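import Summits.CriticalPhenomena.SAWScalingLimit.Theses.SAWLeftRightFKG

/-!
# Line `free-loop-rerouting` — skeleton for crux `FKGToTraversalBound` (stmt-CriticalPhenomena-1878)

Crux (route `SAWLeftRightFKG`, rank 3): `FKGToTraversalBound := LeftRightFKG → SAWTraversalBound`
(`Iff.rfl`, Disproof §1 `iff_imp`): left–right positive association of the critical square-lattice
SAW should give the Aizenman–Burchard hypothesis (H1) for the chordal x_c-SAW.  By Disproof F1
(`not_crux_iff`, `mono_hyp`, `of_traversalBound`) no `_false_without_` certificate can exist and any
proof of (H1) closes the crux; by Disproof F3 / triage r1 (S1, S2, X1, P1) PA is not instantiable on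
the deep-endpoint fragment of (H1) and no uniform-in-the-past engine exists there.  This line proves
(H1) on the boundary-attached class from a SAW-specific engine and isolates the fragment as one
statement-level stub; PA is NOT consumed (triage P3/X3: no ε comes from PA on this crux).

Idea (card `Ideas/free-loop-rerouting.md`, triage r1-1/2/3: pass ×3).  Three layers.

* LAYER 0 (proved here, triage X2): (H1) with its shell-dependent threshold needs neither a rate nor
  cross-shell uniformity — `traversalBound_of_perShellTightness : PerShellTightness →
  SAWTraversalBound` (per-shell tightness of the traversal counts on shells of ONE aspect ratio
  `C₀`, uniform in the mesh only; `k :=` the `(ρ/R)³`-quantile, `K = C₀³`, `λ = 3`; `law ≤ 1` on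
  fatter-than-`C₀` shells).  The ideator's `UniformTraversalTightness` (one `n` for all shells) was
  FALSE (triage W2, r1-3: oscillating prime ends force shell-dependent counts); the per-shell form is
  immune (`traversalBound_iff_threshold_ge`, sibling Negative).
* LAYER 1 (Kemppainen–Smirnov on the lattice): `stub_ksIteration : UnforcedCrossingBound →
  PerShellTightnessBdry` — lattice Condition G2 for the x_c-SAW future in `D_δ ∖ past` with BOTH
  lattice endpoints on `meshBoundary` (the (R1) class of Disproof F3) gives per-shell tightness for
  such endpoint approximations (KS17 arXiv:1212.6215 §2.2 G2 ⇒ G3 by nested annuli, Lemma 3.6 index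
  lemma, Prop. 3.5; forced crossings of a FIXED shell are bounded by the `(R-ρ)`-oscillation count of
  `∂D`, so the per-shell threshold absorbs them).  `stub_deepEndpoints : PerShellTightnessBdry →
  PerShellTightness` is the statement-level residue (deep starts: `exists_isEndpointApprox_deepStart`;
  G2 is false there, triage S1; under the repair (R1) it is `id`).
* LAYER 2 (the engine = the card's lever): `stub_rerouting : FreeLoop → InwardDiveRatio →
  OutwardDiveRatio → UnforcedCrossingBound`.  An avoidable (KS-unforced) annulus component in a
  simply connected slit domain is MONOCHROMATIC, so crossing it is an excursion into a DEAD END: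
  inward (a dive through a door on the circle `ρ` into a pocket) or outward (an escape beyond radius
  `Mρ` into a cul-de-sac, and back).  `stub_freeLoop` (plane topology, TRUE, provable with the
  tree's `wind` API — triage r1-1/2/3) certifies that a closed lattice loop made of the future and a
  witness route encloses NO obstacle: no point of `ℂ ∖ D`, no past vertex, no non-domain site — so a
  dead-end excursion `d` of the future between door sites `u, v` can be REROUTED inside the enclosed
  free region without collision, the SAW weight being multiplicative under the surgery.  The only
  estimates are then CANONICAL door-to-door ratios in round rooms with no fractal data at all:
  `InwardDiveRatio` (dives inside the disc `B(x, ρ)` to depth `ρ/M` versus hovers in the bump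
  `B(m, |u-v|) ∖ B̄(x, ρ)` over the door) and `OutwardDiveRatio` (escapes outside `B(x, ρ)` beyond
  radius `Mρ`, inside an ambient disc `B(x, KMρ)` with constants uniform in `K`, versus hovers in
  `B(m, |u-v|) ∩ B(x, ρ)`), both `→ 0` as the modulus `M → ∞`.  The surgery's two debts — door
  MULTIPLICITY (met by conditioning on the outer configuration of the door disc, an exact two-sided
  domain-Markov identity, so doors are portal pairs and no inverse map is counted) and CONFINEMENT
  (a door whose canonical bump is not free is crowded at scale `|u-v|`; such configurations contain an
  unforced crossing of an annulus of scale `≤ ρ/2` inside a quadrilateral of large modulus and are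
  charged to the SMALLER scale by induction on `⌊log₂(r/δ)⌋`, KS17 §2.2 G2 ⇒ C3) — live inside
  `stub_rerouting`, the hardest stub.

`FKGToTraversalBound_of` concludes the crux BY NAME; `sorry` occurs only in the six `stub_*`.
Typed over the crux's own probability space (`SAW.law` on `DomainSAW D.carrier δ a b`, pasts as
prefix atoms, `meshDomain` / `meshBoundary` / `discreteDomainGraph`); no new structure.
-/

noncomputable section

open MeasureTheory Filter Topology Set Metric
open scoped NNReal ENNReal
open Literature.Probability.LatticeModels
open Literature.Probability.RandomPlanarGeometry
open Literature.Probability.RandomPlanarGeometry.SAW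
open Summit.CriticalPhenomena.SAWScalingLimit.Theses.SAWLeftRightFKG

namespace Summit.CriticalPhenomena.SAWScalingLimit.Cruxes.FKGToTraversalBound.FreeLoopRerouting

/-! ## Vocabulary (slit domains as prefix atoms; lattice annuli; KS-avoidability) -/

variable {Ω : Set ℂ} {δ : ℝ} {a p b : Site 2}

/-- FUTURE-AVAILABLE SITES after the past `η` (a self-avoiding lattice path from `a` to the tip
`p`): sites of the discrete domain `Ω_δ` not visited by `η` (the tip itself is not free). -/
def Free (η : DomainSAW Ω δ a p) (v : Site 2) : Prop :=
  v ∈ meshDomain Ω δ ∧ v ∉ η.walk.support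

/-- The SAW `γ : a → b` EXTENDS the past `η : a → p` (the atom "past = η" of the exploration;
conditioning on it is the domain Markov property of the weight `x_c^{|γ|}`). -/
def Prefix (η : DomainSAW Ω δ a p) (γ : DomainSAW Ω δ a b) : Prop :=
  ∃ q : (discreteDomainGraph Ω δ).Walk p b, γ.walk = η.walk.append q

/-- The site `v` lies in the OPEN annulus `A(x; r, R)` at mesh `δ`. -/
def InAnn (δ : ℝ) (x : ℂ) (r R : ℝ) (v : Site 2) : Prop :=
  r < dist (meshPoint δ v) x ∧ dist (meshPoint δ v) x < R

/-- `s` and `t` lie in the same connected component of (annulus sites) ∩ (free sites) of the slit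
domain: joined by a walk of `Ω_δ` all of whose vertices are free annulus sites (KS17 Def. 2.2: "the
connected component of `z` in `U_τ ∩ A`"). -/
def AnnLinked (η : DomainSAW Ω δ a p) (x : ℂ) (r R : ℝ) (s t : Site 2) : Prop :=
  ∃ q : (discreteDomainGraph Ω δ).Walk s t, ∀ v ∈ q.support, InAnn δ x r R v ∧ Free η v

/-- KS-AVOIDABILITY of the annulus component of `s` (KS17 Def. 2.2, lattice form): some route of the
slit domain from the tip `p` to the target `b` through free sites misses the whole free annulus
component of `s` ("doesn't disconnect `γ(τ)` from `b` in `U_τ`"). -/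
def Avoidable (η : DomainSAW Ω δ a p) (b : Site 2) (x : ℂ) (r R : ℝ) (s : Site 2) : Prop :=
  ∃ q : (discreteDomainGraph Ω δ).Walk p b,
    (∀ v ∈ q.support.tail, Free η v) ∧ ∀ v ∈ q.support, ¬ AnnLinked η x r R s v

/-- KS's clause `∂B(x, r) ∩ ∂U_τ ≠ ∅` in lattice form (KS17 Def. 2.2: `A^u_τ = ∅` otherwise): the
closed inner disc of radius `s` contains an OBSTACLE — a past vertex or a lattice-boundary site of
`Ω_δ` (a domain site with a missing lattice neighbour/edge, `meshBoundary`). Used with `s = r + 2δ`. -/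
def InnerObstacle (η : DomainSAW Ω δ a p) (x : ℂ) (s : ℝ) : Prop :=
  (∃ v ∈ η.walk.support, dist (meshPoint δ v) x ≤ s) ∨
    ∃ v ∈ meshBoundary Ω δ, dist (meshPoint δ v) x ≤ s

/-- The future of `γ` (indices `≥ |η|`) contains an UNFORCED CROSSING of `A(x; r, R)`: a sub-walk
`γ[i, j]` with one end in `B̄(x, r)`, the other outside `B(x, R)` (either orientation, KS17
Def. 1.1), all of whose interior vertices are free annulus sites with AVOIDABLE component ("a
crossing of `A` which is contained in `A^u_τ`").  `i + 2 ≤ j` only records that a crossing has an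
interior vertex (automatic for `R - r > δ`). -/
def UnforcedCrossing (η : DomainSAW Ω δ a p) (x : ℂ) (r R : ℝ) (γ : DomainSAW Ω δ a b) : Prop :=
  ∃ i j : ℕ, η.walk.length ≤ i ∧ i + 2 ≤ j ∧ j ≤ γ.walk.length ∧
    ((dist (meshPoint δ (γ.walk.getVert i)) x ≤ r ∧ R ≤ dist (meshPoint δ (γ.walk.getVert j)) x) ∨
      (R ≤ dist (meshPoint δ (γ.walk.getVert i)) x ∧ dist (meshPoint δ (γ.walk.getVert j)) x ≤ r)) ∧
    ∀ t, i < t → t < j →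
      InAnn δ x r R (γ.walk.getVert t) ∧ Avoidable η b x r R (γ.walk.getVert t)

/-! ## Statements of the line -/

/-- **Lattice Condition G2 for the critical SAW on the boundary-attached class** (KS17 Condition G2
in domain-Markov / time-zero form, Remark 2.8; the target of the engine).  There are a modulus
`C₀ ≥ 8` and `θ < 1` such that for every Dobrushin domain `D`, mesh `δ > 0`, lattice endpoints
`a, b ∈ meshBoundary D_δ` (BOTH attached: the (R1) class of Disproof F3 — for a floating past G2 is
false, triage S1), every self-avoiding past `η : a → p`, and every annulus `A(x; r, C₀ r)` with
`r ≥ δ` whose inner disc (enlarged by `2δ`) contains an obstacle, the conditional probability on the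
atom `{past = η}` that the future makes an unforced crossing of `A(x; r, C₀ r)` is at most `θ`:
`law{Prefix η ∧ UnforcedCrossing} ≤ θ · law{Prefix η}`. -/
def UnforcedCrossingBound : Prop :=
  ∃ (C₀ θ : ℝ), 8 ≤ C₀ ∧ θ < 1 ∧
    ∀ (D : DobrushinDomain) (δ : ℝ) (a b p : Site 2) (η : DomainSAW D.carrier δ a p) (x : ℂ) (r : ℝ),
      0 < δ → δ ≤ r → a ∈ meshBoundary D.carrier δ → b ∈ meshBoundary D.carrier δ →
      InnerObstacle η x (r + 2 * δ) →
        law D.carrier δ a b {γ | Prefix η γ ∧ UnforcedCrossing η x r (C₀ * r) γ}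
          ≤ ENNReal.ofReal θ * law D.carrier δ a b {γ | Prefix η γ}

/-- **Per-shell tightness of the traversal counts** (triage X2's sharpening of the ideator's F1):
for every Dobrushin domain and endpoint approximation there are an aspect ratio `C₀ ≥ 1` and
`δ₀ > 0` such that for every shell `D(x; ρ, R)` with `C₀ ρ ≤ R ≤ 1` and every `ε > 0` ONE
threshold `n` (depending on the shell and on `ε`) makes `n` separate traversals have probability
`≤ ε` at every mesh `δ ≤ min(δ₀, ρ)`.  No rate, no cross-shell uniformity. -/
def PerShellTightness : Prop :=
  ∀ (D : DobrushinDomain) (a b : ℝ → Site 2), IsEndpointApprox D a b →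
    ∃ (C₀ δ₀ : ℝ), 1 ≤ C₀ ∧ 0 < δ₀ ∧
      ∀ (x : ℂ) (ρ R ε : ℝ), 0 < ρ → C₀ * ρ ≤ R → R ≤ 1 → 0 < ε →
        ∃ n : ℕ, ∀ δ ∈ Set.Ioc (0 : ℝ) δ₀, δ ≤ ρ →
          law D.carrier δ (a δ) (b δ)
              {γ | (⟨γ.walk.toCurve (meshPoint δ)⟩ : Curve ℂ).HasTraversals n x ρ R}
            ≤ ENNReal.ofReal ε

/-- Per-shell tightness on the BOUNDARY-ATTACHED class (R1): the same conclusion for endpoint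
approximations whose lattice endpoints eventually lie on the lattice boundary `meshBoundary D_δ`
(Duminil-Copin–Smirnov's "vertices of `Ω_δ` closest to `a, b`"; Disproof F3 (R1)). -/
def PerShellTightnessBdry : Prop :=
  ∀ (D : DobrushinDomain) (a b : ℝ → Site 2), IsEndpointApprox D a b →
    (∀ᶠ δ in 𝓝[>] (0 : ℝ), a δ ∈ meshBoundary D.carrier δ ∧ b δ ∈ meshBoundary D.carrier δ) →
    ∃ (C₀ δ₀ : ℝ), 1 ≤ C₀ ∧ 0 < δ₀ ∧
      ∀ (x : ℂ) (ρ R ε : ℝ), 0 < ρ → C₀ * ρ ≤ R → R ≤ 1 → 0 < ε →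
        ∃ n : ℕ, ∀ δ ∈ Set.Ioc (0 : ℝ) δ₀, δ ≤ ρ →
          law D.carrier δ (a δ) (b δ)
              {γ | (⟨γ.walk.toCurve (meshPoint δ)⟩ : Curve ℂ).HasTraversals n x ρ R}
            ≤ ENNReal.ofReal ε

/-- **Free-loop lemma** (the card's topological half; plane topology, provable with the tree's
`Literature.Topology.PlaneTopology.wind` API — triage r1-1/2/3 all checked the argument): in a
Dobrushin lattice domain `D_δ` with a past `η : a → p` ATTACHED to the lattice boundary
(`a ∈ meshBoundary`), every closed lattice loop `W` at the tip made of future-available sites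
(it meets `η` only at `p`; `W` need not be simple) encloses NO obstacle: every point of nonzero
winding number of its mesh polyline lies in `D`, is not a past vertex, and every lattice site it
covers belongs to the discrete domain `meshDomain D_δ` (no floating hole, no dropped edge, no piece
of the past between two routes).  Proof route: `ℂ ∖ D` is connected, unbounded and misses the trace
(lattice edges ⊆ closure `D` meet only at shared endpoints); `polyline(η) ∖ {δp}` is connected,
misses the trace and reaches the missing neighbour of `a`; enclosed mesh-vertex components have an
easternmost vertex whose east neighbour has winding `0`. -/
def FreeLoop : Prop :=
  ∀ (D : DobrushinDomain) (δ : ℝ) (a p : Site 2) (η : DomainSAW D.carrier δ a p)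
    (W : (discreteDomainGraph D.carrier δ).Walk p p), 0 < δ → a ∈ meshBoundary D.carrier δ →
    (∀ v ∈ W.support, v ∈ η.walk.support → v = p) →
    ∀ z : ℂ, Literature.Topology.PlaneTopology.wind
        (fun t : ℝ => Set.IccExtend zero_le_one (W.toCurve (meshPoint δ)) t - z) ≠ 0 →
      z ∈ D.carrier ∧ (∀ v ∈ η.walk.support, meshPoint δ v ≠ z) ∧
        ∀ v : Site 2, meshPoint δ v = z → v ∈ meshDomain D.carrier δ

/-- **Inward dive ratio** (canonical shadow ratio, inward normal form; RSW-type, open).  For every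
`ε > 0` there is a modulus `M ≥ 2` such that at every mesh `δ`, for every disc `B(x, ρ)` with
`ρ ≥ Mδ` and every pair of DOOR sites `u, v` just outside the circle (`ρ < |δu - x| ≤ ρ + δ`;
the portals of a strand of the future inside the door disc), among the walks `u → v` of the
ambient lattice disc `B(x, 4ρ)_δ` that stay in the closed door disc `B̄(x, ρ + δ)` the x_c-weight
of the DIVES (those reaching `B̄(x, ρ/M)`) is at most `ε` times the weight of the HOVERS (those
staying in the bump `B(m, |δu - δv|)`, `m` the door's midpoint — the shallow reroutings on the
same, resampled, side of the door).  No fractal data: two events of ONE measure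
`SAW.weight (ball x (4ρ)) δ u v`.  Heuristics: boundary excursion exponents, `(|u-v|/ρ)^{5/4}
(1/M)^{2/3} → 0`; at micro-doors (`|u-v| ≍ δ`, hover weight `≥ x_c`) it is a polygon/bubble-type
tail bound (kin of `CriticalBubbleBound`, stmt-7117). -/
def InwardDiveRatio : Prop :=
  ∀ ε : ℝ, 0 < ε → ∃ M : ℝ, 2 ≤ M ∧ ∀ (δ : ℝ) (x : ℂ) (ρ : ℝ) (u v : Site 2),
    0 < δ → M * δ ≤ ρ →
    ρ < dist (meshPoint δ u) x → dist (meshPoint δ u) x ≤ ρ + δ →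
    ρ < dist (meshPoint δ v) x → dist (meshPoint δ v) x ≤ ρ + δ →
      weight (Metric.ball x (4 * ρ)) δ u v
          {γ | (∀ t ∈ γ.walk.support, dist (meshPoint δ t) x ≤ ρ + δ) ∧
            ∃ t ∈ γ.walk.support, dist (meshPoint δ t) x ≤ ρ / M}
        ≤ ENNReal.ofReal ε *
          weight (Metric.ball x (4 * ρ)) δ u v
            {γ | ∀ t ∈ γ.walk.support, dist (meshPoint δ t) x ≤ ρ + δ ∧
              dist (meshPoint δ t) ((meshPoint δ u + meshPoint δ v) / 2)
                ≤ dist (meshPoint δ u) (meshPoint δ v)}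

/-- **Outward dive ratio** (canonical shadow ratio, outward normal form = escape into a cul-de-sac;
RSW-type, open).  For every `ε > 0` there is `M ≥ 2` such that for EVERY ambient radius factor
`K ≥ 2` (constants uniform in `K`: the dead end may be as large as the domain), every mesh `δ`,
disc `B(x, ρ)` with `ρ ≥ Mδ` and door sites `u, v` just inside the circle (`ρ - δ ≤ |δu - x| < ρ`;
the portals of a strand of the future outside the door disc), among the walks `u → v` of
`B(x, KMρ)_δ` that stay outside `B(x, ρ - δ)` the x_c-weight of the ESCAPES (those reaching radius
`Mρ`) is at most `ε` times the weight of the HOVERS (those staying in the bump `B(m, |δu - δv|)`).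
Uniformity in `K` is the finite-volume shadow of the (believed) finiteness and decay of the critical
two-point function at short distance; at micro-doors again bubble-type. -/
def OutwardDiveRatio : Prop :=
  ∀ ε : ℝ, 0 < ε → ∃ M : ℝ, 2 ≤ M ∧ ∀ (K δ : ℝ) (x : ℂ) (ρ : ℝ) (u v : Site 2),
    2 ≤ K → 0 < δ → M * δ ≤ ρ →
    ρ - δ ≤ dist (meshPoint δ u) x → dist (meshPoint δ u) x < ρ →
    ρ - δ ≤ dist (meshPoint δ v) x → dist (meshPoint δ v) x < ρ →
      weight (Metric.ball x (K * M * ρ)) δ u v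
          {γ | (∀ t ∈ γ.walk.support, ρ - δ ≤ dist (meshPoint δ t) x) ∧
            ∃ t ∈ γ.walk.support, M * ρ ≤ dist (meshPoint δ t) x}
        ≤ ENNReal.ofReal ε *
          weight (Metric.ball x (K * M * ρ)) δ u v
            {γ | ∀ t ∈ γ.walk.support, ρ - δ ≤ dist (meshPoint δ t) x ∧
              dist (meshPoint δ t) ((meshPoint δ u + meshPoint δ v) / 2)
                ≤ dist (meshPoint δ u) (meshPoint δ v)}

/-! ## Stubs (registered; `sorry` only here) -/

/-- STUB 1 (topology, M; TRUE — triage r1-1/2/3) — the free-loop lemma in Dobrushin lattice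
domains with an attached past.  Tools: `wind` is locally constant off the trace and `0` on the
unbounded component (cf. Disproof `wind_sub_eq_zero_of_re_le`, `noFloatingHoles`);
`SimpleGraph.Walk.range_toCurve_subset`, `mem_range_toCurve`; two distinct mesh lattice edges meet
only at a common endpoint; `JordanDomain.closure_eq` (`ℂ ∖ D = ∂D ∪ exterior` is connected and
unbounded); `mem_meshBoundary_iff'` for the missing neighbour of `a`. -/
theorem stub_freeLoop : FreeLoop := by
  sorry

/-- STUB 2 (canonical estimate, open, RSW-type; cheapest falsifier = exact enumeration / transfer
matrix of the two events at `M = 4, 8` and `ρ/δ ≤ 12`) — inward dive ratio. -/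
theorem stub_inwardDiveRatio : InwardDiveRatio := by
  sorry

/-- STUB 3 (canonical estimate, open, RSW-type + bubble-type at micro-doors; constants uniform in the
ambient factor `K`) — outward dive ratio. -/
theorem stub_outwardDiveRatio : OutwardDiveRatio := by
  sorry

/-- STUB 4 (HARDEST — the rerouting surgery; the card's lever) — free loop + the two canonical ratios
give lattice G2 on the attached class.  Scheme: (a) NORMAL FORM: an avoidable component `V` (with
the obstacle clause) of `A(x; r, C₀r) ∩ U`, `U = D_δ ∖ η`, touches only ONE bank of `∂U` (both
banks ⇒ a crosscut in `V` separates tip from `b` ⇒ forced), and two crossing-capable components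
cannot both carry a route tip → `b` (circle-parity of `wind` of the loop route₁·route₂⁻¹, which is
`0` at every obstacle by `FreeLoop`); hence the region entered through `V` is a DEAD END and a
crossing of `V` by the future lies on an excursion `d = γ[u, v]` that returns through its DOOR
circle: inward — door radius `ρ := Mr`, `d` stays in `B̄(x, ρ + δ)` and reaches `B̄(x, r) =
B̄(x, ρ/M)`; outward (tip or target inside) — door radius `ρ := C₀r/M`, `d` stays outside
`B(x, ρ - δ)` and reaches radius `C₀r = Mρ`; here `M = M(ε)` is the modulus of stubs 2–3 and
`C₀ := 8M²` (so `Mr ≤ C₀r/M`: both door circles lie inside the annulus); (b) SURGERY: by `FreeLoop`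
applied to `(future) · (witness route)⁻¹` the region enclosed between the excursion and the route is
free of `ℂ ∖ D`, of the past and of non-domain sites, so replacing `d` by ANY self-avoiding hover
`h : u → v` on the same side of the door circle inside (free region ∩ bump `B(m, |δu - δv|)`) yields a
SAW `a → b` of `D_δ` extending `η`, of weight `x_c^{|γ| - |d| + |h|}` (exact: the weight is
multiplicative); (c) MULTIPLICITY: condition on the configuration of the future on the NEAR side of
the door circle (its lattice edges with both ends on the side the excursion does not enter — an exact
two-sided domain-Markov identity, cf. line radial-portal-transfer's `outEdgeSet`): given it, doors are
the portal pairs `(u_i, v_i)` and the far side is a system of vertex-disjoint strands in the free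
region, so `P(some strand dives ∣ near side) ≤ Σ_i Z_dive(i)/Z_hover(i)` with NO inverse-map counting;
by inclusion (`SimpleGraph.Walk.map` along a subgraph embedding, bounded `D ⊆ B(x, KMρ)`) `Z_dive(i)`
is at most the canonical dive/escape weight of stubs 2–3, and when the bump of door `i` on the far
side is free of obstacles AND of the other strands, `Z_hover(i)` is at least the canonical hover
weight; the canonical profile is summable over the disjoint door arcs of one circle
(`Σ_i (s_i/ρ)^{5/4} ≤ C`, `Σ_i s_i ≤ 2πρ + O(δ)`), giving `≤ Cε`; (d) CONFINEMENT: a crowded door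
(bump not free at its own scale `s_i`) has an obstacle or another strand within `s_i` on the far
side; obstacle-crowding plus the excursion contains an unforced crossing of an annulus of scale
`≤ ρ/2` centred near the door inside a quadrilateral of modulus `≳ log(1/ε')`, charged to the SMALLER
scale by the induction hypothesis on `⌊log₂(r/δ)⌋`, upgraded to a power law by KS nesting (KS17 §2.2,
G2 ⇒ G3, `Δ = log(1/θ)/log C₀`); strand-crowding is symmetrised over the pair of strands (the crowding
strand is itself an excursion with a crowded door); the base of the induction (`r < 8Mδ`) is a finite
lattice-scale surgery (Kesten-pattern type).  PA (`LeftRightFKG`) is available for one-sided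
carve/fill comparisons (Sandwich = CarveCore, triage X3: carving the hover side INCREASES the dive
probability, filling the dead end INCREASES it) but is expected to stay idle. -/
theorem stub_rerouting :
    FreeLoop → InwardDiveRatio → OutwardDiveRatio → UnforcedCrossingBound := by
  sorry

/-- STUB 5 (XL, charted: Kemppainen–Smirnov on the lattice) — lattice G2 on the attached class gives
per-shell tightness for boundary-attached endpoint approximations.  Ingredients (KS17
arXiv:1212.6215): §2.2 nested annuli `A_j = A(x, C₀^{j-1} r, C₀^j r)` ⇒ power law `2(r/R)^Δ`,
`Δ = log(1/θ)/log C₀` for a single unforced crossing (conditional probabilities multiply along the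
stopping times = prefix atoms, `Prefix`); Lemma 3.6 (index `I_t` = minimal number of `A₂`-crossings
among lattice futures tip → `b` in `D_δ ∖ past`, changes by `±1` per `A₂`-crossing, two consecutive
increases ⇒ the latter crossing is unforced in the domain at its start; `#crossings of A ≤ I₀ +
2·#unforced`); Prop. 3.5 ⇒ `P(≥ I₀(δ) + 2m crossings of D(x; ρ, R)) ≤ C(m, I₀) (6 (ρ/R)^{Δ/3})^m`.
Attached endpoints keep every `D_δ ∖ γ[0,t]` in the class of `UnforcedCrossingBound` and make the
lattice target one-sided (no two-sided access to `b`, cf. the free-loop argument); for a FIXED shell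
`sup_{δ ≤ δ₁} I₀(δ)` is bounded by the number of `(R-ρ)`-oscillations of the Jordan curve `∂D`
(`Curve.exists_not_hasTraversals`, `JordanDomain.exists_modulus`) and meshes `δ ∈ (δ₁, δ₀]` carry
boundedly many traversals; so `C₀' := C₀^{3}·6^{3/Δ}`-fat shells have geometric tails in `m`,
uniformly in `δ` — which is `PerShellTightnessBdry` (aspect `C₀'`, `n := I₀ + 2m(ε)`).  Templates in
tree: `Percolation.bondExploration_traversalBound_holds`, `fkInterface_traversalBound_of_annulusCrossing_le`
(forced count via boundary modulus, binomial absorption of forced trials). -/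
theorem stub_ksIteration : UnforcedCrossingBound → PerShellTightnessBdry := by
  sorry

/-- STUB 6 (statement-level residue, NOT this line's mechanism — Disproof F3 (R1)/(R2), triage
S1/S2/X1/P1) — the deep-endpoint reduction: per-shell tightness for boundary-attached approximations
implies it for all `IsEndpointApprox` (starts/targets at lattice depth up to `δ^{-1/2}`,
`exists_isEndpointApprox_deepStart`).  Needs an estimate AVERAGED over pasts near a deep marked point
(whole-plane return exponent `x₃ - x₁ = 3/2` per return to the `√δ`-neighbourhood of the start) or
the statement repair (R1) (endpoints := closest boundary vertices, DCS12 Conjecture 1 verbatim),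
under which it is `id`.  No uniform-in-past engine can reach it (G2 is false for floating pasts,
triage S1 ring witness, kit j011295). -/
theorem stub_deepEndpoints : PerShellTightnessBdry → PerShellTightness := by
  sorry

/-! ## Composition (sorry-free) -/

/-- Whatever the junk conventions, the SAW law gives mass at most `1` to every event. -/
theorem law_le_one (Ω : Set ℂ) (δ : ℝ) (u v : Site 2) (S : Set (DomainSAW Ω δ u v)) :
    law Ω δ u v S ≤ 1 := by
  calc law Ω δ u v S ≤ law Ω δ u v Set.univ := measure_mono (Set.subset_univ _)
    _ = (weight Ω δ u v Set.univ)⁻¹ * weight Ω δ u v Set.univ := by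
        rw [law, Measure.smul_apply, smul_eq_mul]
    _ ≤ 1 := ENNReal.inv_mul_le_one _

/-- Real power with exponent `3` is the monomial. -/
theorem rpow_three (t : ℝ) : t ^ (3 : ℝ) = t ^ (3 : ℕ) := by
  rw [← Real.rpow_natCast]; norm_num

/-- **Quantile reduction (proved; triage X2).**  Per-shell tightness of the traversal counts on
shells of one aspect ratio `C₀`, uniform in the mesh only, already gives the Aizenman–Burchard
hypothesis (H1) of the route: `λ = 3`, `K = C₀³`, threshold `k(x, ρ, R) :=` the `(ρ/R)³`-quantile
of the shell (and `0` off range, where `K (ρ/R)³ ≥ 1 ≥ law`).  "Letting the threshold depend on the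
shell costs nothing" (CurveTightness module doc): no rate and no cross-shell uniformity is needed. -/
theorem traversalBound_of_perShellTightness (h : PerShellTightness) : SAWTraversalBound := by
  intro D a b hab
  obtain ⟨C₀, δ₀, hC₀, hδ₀, H⟩ := h D a b hab
  -- one threshold per shell (junk `0` off range)
  have H' : ∀ (x : ℂ) (ρ R : ℝ), ∃ n : ℕ, 0 < ρ → C₀ * ρ ≤ R → R ≤ 1 →
      ∀ δ ∈ Set.Ioc (0 : ℝ) δ₀, δ ≤ ρ →
        law D.carrier δ (a δ) (b δ)
            {γ | (⟨γ.walk.toCurve (meshPoint δ)⟩ : Curve ℂ).HasTraversals n x ρ R}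
          ≤ ENNReal.ofReal ((ρ / R) ^ (3 : ℕ)) := by
    intro x ρ R
    by_cases hc : 0 < ρ ∧ C₀ * ρ ≤ R ∧ R ≤ 1
    · have hR : 0 < R := by nlinarith [hc.1, hc.2.1, hC₀]
      have hε : 0 < (ρ / R) ^ (3 : ℕ) := pow_pos (div_pos hc.1 hR) 3
      obtain ⟨n, hn⟩ := H x ρ R ((ρ / R) ^ (3 : ℕ)) hc.1 hc.2.1 hc.2.2 hε
      exact ⟨n, fun _ _ _ => hn⟩
    · exact ⟨0, fun h1 h2 h3 => absurd ⟨h1, h2, h3⟩ hc⟩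
  choose k hk using H'
  have hC₀' : (0 : ℝ) ≤ C₀ := zero_le_one.trans hC₀
  refine ⟨k, C₀ ^ (3 : ℕ), 3, δ₀, pow_nonneg hC₀' 3, by norm_num, hδ₀, ?_⟩
  intro δ hδ x ρ R hδρ hρR hR1
  have hρ : 0 < ρ := hδ.1.trans_le hδρ
  have hR : 0 < R := hρ.trans hρR
  have hq0 : 0 ≤ ρ / R := (div_pos hρ hR).le
  rw [rpow_three]
  by_cases hc : C₀ * ρ ≤ R
  · refine (hk x ρ R hρ hc hR1 δ hδ hδρ).trans (ENNReal.ofReal_le_ofReal ?_)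
    have h1 : (1 : ℝ) ≤ C₀ ^ (3 : ℕ) := one_le_pow₀ hC₀
    have h2 : 0 ≤ (ρ / R) ^ (3 : ℕ) := pow_nonneg hq0 3
    nlinarith
  · push Not at hc
    calc law D.carrier δ (a δ) (b δ)
            {γ | (⟨γ.walk.toCurve (meshPoint δ)⟩ : Curve ℂ).HasTraversals (k x ρ R) x ρ R}
          ≤ 1 := law_le_one _ _ _ _ _
      _ ≤ ENNReal.ofReal (C₀ ^ (3 : ℕ) * (ρ / R) ^ (3 : ℕ)) := by
          rw [← ENNReal.ofReal_one]
          apply ENNReal.ofReal_le_ofReal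
          have h1 : 1 ≤ C₀ * (ρ / R) := by
            rw [mul_div_assoc', le_div_iff₀ hR]; linarith
          calc (1 : ℝ) = 1 ^ (3 : ℕ) := by norm_num
            _ ≤ (C₀ * (ρ / R)) ^ (3 : ℕ) := pow_le_pow_left₀ zero_le_one h1 3
            _ = C₀ ^ (3 : ℕ) * (ρ / R) ^ (3 : ℕ) := by ring

/-- The engine and the two reductions give (H1) outright (an `of_traversalBound` line, Disproof F1). -/
theorem sawTraversalBound_of_stubs : SAWTraversalBound :=
  traversalBound_of_perShellTightness
    (stub_deepEndpoints
      (stub_ksIteration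
        (stub_rerouting stub_freeLoop stub_inwardDiveRatio stub_outwardDiveRatio)))

/-- **`FKGToTraversalBound` from the stubs.**  The crux is the implication PA → (H1) (`Iff.rfl`);
PA is not consumed (Disproof F1 `mono_hyp` / `of_traversalBound`; triage P3): the free-loop engine
(stubs 1–4) gives lattice G2 on the attached class, Kemppainen–Smirnov (stub 5) turns it into
per-shell tightness there, the deep-endpoint residue (stub 6) extends it to every endpoint
approximation, and the proved quantile reduction assembles (H1). -/
theorem FKGToTraversalBound_of : FKGToTraversalBound := fun _ => sawTraversalBound_of_stubs

end Summit.CriticalPhenomena.SAWScalingLimit.Cruxes.FKGToTraversalBound.FreeLoopRerouting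

end
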